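import Summits.CriticalPhenomena.SAWScalingLimit.Theorems.SAWDefectDecoherenceBoundaryClosureRSidePhaseCorner
import Summits.CriticalPhenomena.SAWScalingLimit.Theorems.SAWDefectDecoherenceBoundaryClosureRSidePhaseCornerGeometry
import Literature.Probability.RandomPlanarGeometry.HexSAWLattice
import HarnessLib

/-!
# Boundary darts exist near every point of an exact zigzag side
(crux `BoundaryClosureR`, stmt-CriticalPhenomena-14004, line `polygon-parity-squeeze`, sub-goal of the
registered stub `polygonLocalIdentity`, step (a); registered helper `exists_dart_of_exact`)

Lattice geometry of the six exact zigzag half-lattices `{v | n ≤ zigzagForm k v}`: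

* `exists_hexCenter_near`: every point of the plane is within `2` of a face centre;
* `zigzagForm_le_of_dist`: the form is Lipschitz in the centre, `f_k w ≤ f_k v + 2·dist + 1`;
* `twoStep`: from every face there is a two-step path `v ∼ w₁ ∼ w₂` along which the form `k` does not
  increase and drops by exactly one at `w₂` (form `0` by hand, the other forms by the face rotation
  `hexRot60`, `SidePhaseCorner.zigzagForm_rot`);
* **`exists_dart_of_exact`**: if `Λ` is the exact half-lattice of form `k` on `ball x R` and contains a
  face `v` with centre in `ball x r`, `r + 2N + 1 ≤ R`, of form `< n + N`, then `Λ` has a boundary dart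
  `p ∼ t` (`p ∈ Λ`, `t ∉ Λ`) with `c_p ∈ ball x (r + 2N)` (descend along two-step paths until the
  threshold is crossed);
* `exists_dart_of_exact_of_notMem`: the same from a face of `Λ` and a face off `Λ` in `ball x r`,
  `9r + 5 ≤ R`.

References: folklore (geometry of the honeycomb lattice).  No definition is introduced.
-/

noncomputable section

open scoped ComplexConjugate
open Set Metric
open Literature.Probability.LatticeModels
open Literature.Probability.Percolation (hexCenter_im hexCenter_re)
open Literature.Probability.RandomPlanarGeometry.SAW (hexGraph_adj_iff_coord)
open Summit.CriticalPhenomena.SAWScalingLimit.Theorems.ObservableToSLER.BridgeGate (hexRot60 hexRotNeg60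
  hexRot60_hexRotNeg60 hexGraph_adj_hexRot60_iff hexCenter_hexRot60)

namespace Summit.CriticalPhenomena.SAWScalingLimit.Theorems.PolygonParitySqueeze.PolygonLocal

/-! ### 1. Face centres are `2`-dense -/

/-- **Every point of the plane is within `2` of a face centre** (round the row, then the column).
[folklore] -/
theorem exists_hexCenter_near (w : ℂ) : ∃ v : HexVertex, dist (hexCenter v) w ≤ 2 := by
  set y₁ : ℤ := ⌊w.im * (2 / Real.sqrt 3)⌋ with hy₁
  set y₀ : ℤ := ⌊w.re - (y₁ : ℝ) / 2⌋ with hy₀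
  refine ⟨(![y₀, y₁], 0), ?_⟩
  have h3 : 0 < Real.sqrt 3 := Real.sqrt_pos.2 (by norm_num)
  have h3' : Real.sqrt 3 * Real.sqrt 3 = 3 := Real.mul_self_sqrt (by norm_num)
  have hs3 : Real.sqrt 3 < 2 := by
    rw [show (2 : ℝ) = Real.sqrt 4 by rw [show (4 : ℝ) = 2 ^ 2 by norm_num, Real.sqrt_sq (by norm_num)]]
    exact Real.sqrt_lt_sqrt (by norm_num) (by norm_num)
  have hre : (hexCenter ((![y₀, y₁], 0) : HexVertex)).re = y₀ + (y₁ : ℝ) / 2 + 1 / 2 := by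
    rw [hexCenter_re]; simp
  have him : (hexCenter ((![y₀, y₁], 0) : HexVertex)).im = ((y₁ : ℝ) + 1 / 3) * (Real.sqrt 3 / 2) := by
    rw [hexCenter_im]; simp
  have h0 := Int.floor_le (w.re - (y₁ : ℝ) / 2)
  have h0' := Int.lt_floor_add_one (w.re - (y₁ : ℝ) / 2)
  have h1 := Int.floor_le (w.im * (2 / Real.sqrt 3))
  have h1' := Int.lt_floor_add_one (w.im * (2 / Real.sqrt 3))
  rw [← hy₀] at h0 h0'
  rw [← hy₁] at h1 h1'
  have hreb : |(hexCenter ((![y₀, y₁], 0) : HexVertex) - w).re| ≤ 1 / 2 := by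
    rw [Complex.sub_re, hre, abs_le]; constructor <;> linarith
  have himb : |(hexCenter ((![y₀, y₁], 0) : HexVertex) - w).im| ≤ 3 / 2 := by
    rw [Complex.sub_im, him, abs_le]
    have e1 : (y₁ : ℝ) * (Real.sqrt 3 / 2) ≤ w.im := by
      have := mul_le_mul_of_nonneg_right h1 (le_of_lt (half_pos h3))
      calc (y₁ : ℝ) * (Real.sqrt 3 / 2) ≤ w.im * (2 / Real.sqrt 3) * (Real.sqrt 3 / 2) := this
        _ = w.im := by field_simp
    have e2 : w.im < ((y₁ : ℝ) + 1) * (Real.sqrt 3 / 2) := by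
      have := mul_lt_mul_of_pos_right h1' (half_pos h3)
      calc w.im = w.im * (2 / Real.sqrt 3) * (Real.sqrt 3 / 2) := by field_simp
        _ < ((y₁ : ℝ) + 1) * (Real.sqrt 3 / 2) := this
    constructor <;> nlinarith
  calc dist (hexCenter ((![y₀, y₁], 0) : HexVertex)) w
      = ‖hexCenter ((![y₀, y₁], 0) : HexVertex) - w‖ := dist_eq_norm _ _
    _ ≤ |(hexCenter ((![y₀, y₁], 0) : HexVertex) - w).re| + |(hexCenter ((![y₀, y₁], 0) : HexVertex) - w).im| :=
        Complex.norm_le_abs_re_add_abs_im _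
    _ ≤ 1 / 2 + 3 / 2 := add_le_add hreb himb
    _ = 2 := by norm_num

/-! ### 2. The form is Lipschitz in the centre -/

/-- **`f_k w ≤ f_k v + 2·dist(c_w, c_v) + 1`** (level dictionary: the level `Re(c · conj n_k)` is
`(√3/2) f_k + O(1)` and `1`-Lipschitz). [folklore] -/
theorem zigzagForm_le_of_dist (k : Fin 6) (v w : HexVertex) :
    (zigzagForm k w : ℝ) ≤ zigzagForm k v + 2 * dist (hexCenter w) (hexCenter v) + 1 := by
  have hw := level_ge k w
  have hv := level_le k v
  have hd := abs_level_le_dist k (hexCenter v) (hexCenter w)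
  have hsplit : ((hexCenter w - hexCenter v) * conj (innerNormal k)).re =
      (hexCenter w * conj (innerNormal k)).re - (hexCenter v * conj (innerNormal k)).re := by
    rw [sub_mul, Complex.sub_re]
  rw [hsplit] at hd
  have hd' := (abs_le.1 hd).2
  have h3 : 1 ≤ Real.sqrt 3 := by
    rw [show (1 : ℝ) = Real.sqrt 1 by rw [Real.sqrt_one]]
    exact Real.sqrt_le_sqrt (by norm_num)
  have hdist : 0 ≤ dist (hexCenter w) (hexCenter v) := dist_nonneg
  rcases neg_one_pow_fin_six k with hs | hs <;> rw [hs] at hw hv <;> nlinarith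

/-! ### 3. Two-step descent along the six forms -/

/-- **Two-step descent, form `0`**: from every face `v` there are `w₁ ∼ v`, `w₂ ∼ w₁` with
`f₀ v - 1 ≤ f₀ w₁ ≤ f₀ v` and `f₀ w₂ = f₀ v - 1`. [folklore] -/
theorem twoStep_zero (v : HexVertex) : ∃ w₁ w₂ : HexVertex, hexGraph.Adj v w₁ ∧ hexGraph.Adj w₁ w₂ ∧
    zigzagForm 0 w₁ ≤ zigzagForm 0 v ∧ zigzagForm 0 v - 1 ≤ zigzagForm 0 w₁ ∧
    zigzagForm 0 w₂ = zigzagForm 0 v - 1 := by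
  obtain ⟨y, t⟩ := v
  fin_cases t
  · refine ⟨(![y 0, y 1 - 1], 1), (![y 0, y 1 - 1], 0), ?_, ?_, ?_, ?_, ?_⟩
    · rw [hexGraph_adj_iff_coord]; simp
    · rw [hexGraph_adj_iff_coord]; simp
    all_goals simp [zigzagForm]
  · refine ⟨(y, 0), (![y 0, y 1 - 1], 1), ?_, ?_, ?_, ?_, ?_⟩
    · rw [hexGraph_adj_iff_coord]; simp
    · rw [hexGraph_adj_iff_coord]; simp
    all_goals simp [zigzagForm]

/-- **Transport of the two-step descent along the face rotation** `σ = hexRot60`: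
`f_{ρ k} ∘ σ = f_k + s_k` (`SidePhaseCorner.zigzagForm_rot`), `σ` is a graph automorphism. [folklore] -/
theorem twoStep_rot {k j : Fin 6} (hj : j = (![3, 2, 4, 5, 0, 1] : Fin 6 → Fin 6) k)
    (h : ∀ v : HexVertex, ∃ w₁ w₂ : HexVertex, hexGraph.Adj v w₁ ∧ hexGraph.Adj w₁ w₂ ∧
      zigzagForm k w₁ ≤ zigzagForm k v ∧ zigzagForm k v - 1 ≤ zigzagForm k w₁ ∧
      zigzagForm k w₂ = zigzagForm k v - 1) :
    ∀ v : HexVertex, ∃ w₁ w₂ : HexVertex, hexGraph.Adj v w₁ ∧ hexGraph.Adj w₁ w₂ ∧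
      zigzagForm j w₁ ≤ zigzagForm j v ∧ zigzagForm j v - 1 ≤ zigzagForm j w₁ ∧
      zigzagForm j w₂ = zigzagForm j v - 1 := by
  intro v
  obtain ⟨w₁, w₂, h1, h2, h3, h4, h5⟩ := h (hexRotNeg60 v)
  have hf : ∀ w : HexVertex, zigzagForm j (hexRot60 w) = zigzagForm k w + (![1, -1, 0, 0, 0, 0] : Fin 6 → ℤ) k :=
    fun w => by rw [hj]; exact SidePhaseCorner.zigzagForm_rot k w
  have hv : hexRot60 (hexRotNeg60 v) = v := hexRot60_hexRotNeg60 v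
  refine ⟨hexRot60 w₁, hexRot60 w₂, ?_, (hexGraph_adj_hexRot60_iff _ _).2 h2, ?_, ?_, ?_⟩
  · have := (hexGraph_adj_hexRot60_iff (hexRotNeg60 v) w₁).2 h1
    rwa [hv] at this
  · have e := hf (hexRotNeg60 v); rw [hv] at e; rw [hf, e]; omega
  · have e := hf (hexRotNeg60 v); rw [hv] at e; rw [hf, e]; omega
  · have e := hf (hexRotNeg60 v); rw [hv] at e; rw [hf, e]; omega

/-- **Two-step descent for all six forms** (the rotation `ρ = (3,2,4,5,0,1)` is a `6`-cycle through
`0 → 3 → 5 → 1 → 2 → 4`). [folklore] -/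
theorem twoStep (k : Fin 6) (v : HexVertex) : ∃ w₁ w₂ : HexVertex, hexGraph.Adj v w₁ ∧ hexGraph.Adj w₁ w₂ ∧
    zigzagForm k w₁ ≤ zigzagForm k v ∧ zigzagForm k v - 1 ≤ zigzagForm k w₁ ∧
    zigzagForm k w₂ = zigzagForm k v - 1 := by
  have h0 := twoStep_zero
  have h3 := twoStep_rot (k := 0) (j := 3) rfl h0
  have h5 := twoStep_rot (k := 3) (j := 5) rfl h3
  have h1 := twoStep_rot (k := 5) (j := 1) rfl h5
  have h2 := twoStep_rot (k := 1) (j := 2) rfl h1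
  have h4 := twoStep_rot (k := 2) (j := 4) rfl h2
  fin_cases k
  · exact h0 v
  · exact h1 v
  · exact h2 v
  · exact h3 v
  · exact h4 v
  · exact h5 v

/-! ### 4. Darts near a face of bounded form -/

/-- **Boundary darts of an exact half-lattice, quantitative.**  If `Λ` is the exact half-lattice of form
`k`, threshold `n`, on `ball x R`, and `v ∈ Λ` has centre in `ball x r` with `r + 2N + 1 ≤ R` and
form `< n + N`, then some dart `p ∼ t`, `p ∈ Λ`, `t ∉ Λ`, has `c_p ∈ ball x (r + 2N)` (induction on
`N` along two-step descents, each step of length `≤ 3/5`). [folklore] -/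
theorem exists_dart_of_exact : ∀ (Λ : Finset HexVertex) (k : Fin 6) (n : ℤ) (x : ℂ) (R : ℝ), (∀ v : HexVertex, hexCenter v ∈ Metric.ball x R → (v ∈ Λ ↔ n ≤ zigzagForm k v)) → ∀ (N : ℕ) (v : HexVertex) (r : ℝ), v ∈ Λ → hexCenter v ∈ Metric.ball x r → r + 2 * N + 1 ≤ R → zigzagForm k v < n + N → ∃ p t : HexVertex, p ∈ Λ ∧ t ∉ Λ ∧ hexGraph.Adj p t ∧ hexCenter p ∈ Metric.ball x (r + 2 * N) := by
  intro Λ k n x R hpin N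
  induction N with
  | zero =>
      intro v r hv hvr hrR hf
      have hvR : hexCenter v ∈ ball x R := ball_subset_ball (by push_cast at hrR; linarith) hvr
      have := (hpin v hvR).1 hv
      push_cast at hf
      omega
  | succ N ih =>
      intro v r hv hvr hrR hf
      obtain ⟨w₁, w₂, h1, h2, h3, -, h5⟩ := twoStep k v
      have hd1 : dist (hexCenter w₁) (hexCenter v) ≤ 3 / 5 := by
        rw [dist_comm]; exact SidePhaseCorner.dist_hexCenter_le_of_adj h1
      have hd2 : dist (hexCenter w₂) (hexCenter w₁) ≤ 3 / 5 := by
        rw [dist_comm]; exact SidePhaseCorner.dist_hexCenter_le_of_adj h2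
      have hvr' := mem_ball.1 hvr
      have hw₁r : hexCenter w₁ ∈ ball x (r + 1) := mem_ball.2 (by
        have := dist_triangle (hexCenter w₁) (hexCenter v) x; linarith)
      have hw₂r : hexCenter w₂ ∈ ball x (r + 2) := mem_ball.2 (by
        have := dist_triangle (hexCenter w₂) (hexCenter w₁) x
        have := dist_triangle (hexCenter w₁) (hexCenter v) x; linarith)
      push_cast at hrR hf
      have hsub : ball x (r + 2) ⊆ ball x R := ball_subset_ball (by linarith)
      by_cases hw₁ : w₁ ∈ Λ
      · by_cases hw₂ : w₂ ∈ Λ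
        · obtain ⟨p, t, hp, ht, hpt, hpb⟩ := ih w₂ (r + 2) hw₂ hw₂r (by linarith) (by rw [h5]; linarith)
          exact ⟨p, t, hp, ht, hpt, by convert hpb using 2; push_cast; ring⟩
        · exact ⟨w₁, w₂, hw₁, hw₂, h2, ball_subset_ball (by push_cast; linarith) hw₁r⟩
      · exact ⟨v, w₁, hv, hw₁, h1, ball_subset_ball (by push_cast; linarith) hvr⟩

/-- **Boundary darts between a face of `Λ` and a face off `Λ`.**  If `Λ` is the exact half-lattice of
form `k` on `ball x R` and `ball x r` (`9r + 5 ≤ R`, `0 ≤ r`) contains the centre of a face of `Λ` and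
of a face not in `Λ`, then some dart `p ∼ t`, `p ∈ Λ ∌ t`, has `c_p ∈ ball x R`... indeed in
`ball x (9r + 5)`. [folklore] -/
theorem exists_dart_of_exact_of_notMem : ∀ (Λ : Finset HexVertex) (k : Fin 6) (n : ℤ) (x : ℂ) (R r : ℝ), (∀ v : HexVertex, hexCenter v ∈ Metric.ball x R → (v ∈ Λ ↔ n ≤ zigzagForm k v)) → 0 ≤ r → 9 * r + 5 ≤ R → ∀ v₁ v₂ : HexVertex, v₁ ∉ Λ → v₂ ∈ Λ → hexCenter v₁ ∈ Metric.ball x r → hexCenter v₂ ∈ Metric.ball x r → ∃ p t : HexVertex, p ∈ Λ ∧ t ∉ Λ ∧ hexGraph.Adj p t ∧ hexCenter p ∈ Metric.ball x (9 * r + 5) := by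
  intro Λ k n x R r hpin hr hR v₁ v₂ hv₁ hv₂ hb₁ hb₂
  -- the form of `v₁` is below the threshold, that of `v₂` at most `4r + 1` above it
  have hf₁ : zigzagForm k v₁ < n := by
    by_contra hle
    push Not at hle
    exact hv₁ ((hpin v₁ (ball_subset_ball (by linarith) hb₁)).2 hle)
  have hd : dist (hexCenter v₂) (hexCenter v₁) < 2 * r := by
    have h1 := mem_ball.1 hb₁
    have h2 := mem_ball.1 hb₂
    have := dist_triangle (hexCenter v₂) x (hexCenter v₁)
    rw [dist_comm x] at this
    linarith
  have hf₂ := zigzagForm_le_of_dist k v₁ v₂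
  set N : ℕ := ⌊4 * r⌋₊ + 2 with hN
  have hNr : 4 * r + 1 < N := by
    rw [hN]; push_cast
    have := Nat.lt_floor_add_one (4 * r)
    linarith
  have hNr' : (N : ℝ) ≤ 4 * r + 2 := by
    rw [hN]; push_cast
    have := Nat.floor_le (show 0 ≤ 4 * r by linarith)
    linarith
  have hf₂' : zigzagForm k v₂ < n + N := by
    have h1 : (zigzagForm k v₂ : ℝ) < n + N := by
      have : (zigzagForm k v₁ : ℝ) + 1 ≤ n := by exact_mod_cast hf₁
      nlinarith
    exact_mod_cast h1
  obtain ⟨p, t, hp, ht, hpt, hpb⟩ := exists_dart_of_exact Λ k n x R hpin N v₂ r hv₂ hb₂ (by linarith) hf₂'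
  exact ⟨p, t, hp, ht, hpt, ball_subset_ball (by linarith) hpb⟩

end Summit.CriticalPhenomena.SAWScalingLimit.Theorems.PolygonParitySqueeze.PolygonLocal

end
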